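import Summits.QuantumFields.BalabanUV.T4Continuum.Support.GradedWellData
import Summits.QuantumFields.BalabanUV.T4Continuum.Support.StarCarrierComponents
import Summits.QuantumFields.BalabanUV.T4Continuum.Support.DirichletCornerRegularity
import Summits.QuantumFields.BalabanUV.T4Continuum.Support.BalabanAveragedTowerUnit

/-!
# T⁴ programme, spine node NE2 (U1a), sub-row Δ1 — THE GRADED WELL, socket (GW-L), brick 1: THE TWO-LEVEL PAIRING OF THE TORUS VECTOR
# LAPLACIAN `LapV` AFTER KING's PLANTING, AT RATE `N⁻¹` (no wall, no carrier), and the split of the `localGW` pairing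

NE2 formalisation swarm `b2b-balaban-t4-ne2-formalise-*`, LEAF PROVER 01 (gen 11).  Owner rulings R47 (e) / R48 (c) (journal `CLAIMS.log`
2026-08-21 l.25022 / l.25393: model of record = the GRADED WELL; «(GW-L) → leaf-03 / leaf-01»; (GW-L) =
`‖localGW(k+1)⁻¹·JGW k − JGW k·localGW(k)⁻¹‖ ≤ Cl·L^{−k}` with `localGW = LapV + a•Q_GWᴴQ_GW` ON THE TORUS, `GradedWellData.localGW_eq`);
leaf-03-g9's map l.25499 («torus pairing + graded line-mass commutator»); INTENT l.25692.  STATUS after owner R49 (l.≈25770, torus transfer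
`GradedWellTorusTransfer`): (GW-L) is OFF the critical path — this file is an OPTIONAL brick of the alternative route (file 5
`GradedWellResolventTower.hinjK_GW_of_local`); nothing of the row waits on it.

WHAT.  The Laplacian half of (GW-L) in the pairing currency.  On the torus the vector Laplacian and King's vector planting `JK` both act
COMPONENT BY COMPONENT (`comp_LapV_mulVec`: `(LapV u)_ν = Δ u_ν`; `comp_JK_mulVec`: `(JK u)_ν = J₀ u_ν`, from this lineage's P4a
`StarCarrierComponents.JK_apply_eq`), so the two-level pairing `⟨v, (JK·LapV_N − LapV_{RN}·JK) u⟩` is the sum over `ν` of gan24-p2's SCALAR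
torus pairings `⟨v_ν, (J₀·Δ_N − Δ_{RN}·J₀) u_ν⟩` (`DirichletBoxTwoLevel.pairing_le` at `S := ⊤` — every site is a block site, the support
hypotheses are vacuous), each `≤ cDir R / N·√(Σ_μ budget_μ u_ν)·√(Σ_μ budget′_μ v_ν)`; Cauchy–Schwarz over `ν` and the TORUS budgets
`Σ_μ budget ⊤ n μ z = Σ_μ ‖∂_μ z‖² + Σ_μ Σ_x |(∂_μᴴ∂_μ z)(x)|² ≤ Re⟨z, Δz⟩ + ‖Δz‖²` (`form_LapS`; leaf-09-g10's `cornerFree_univ` in gan24's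
`hdiag_le_sum_normSq_LapS` — the torus is corner-free) give

 **`pairing_LapV_le (hN : 1 ≤ N) u v : ‖⟨v, (JK·LapV_N − LapV_{RN}·JK) u⟩‖ ≤ (cDir R / N)·√(Re⟨u,LapV u⟩ + ‖LapV u‖²)·√(Re⟨v,LapV′v⟩ + ‖LapV′v‖²)`**

— rate `N⁻¹` (NOT the `(√N)⁻¹` of the hard-wall member: there is no wall), and along King's tower (`N = lev L k`, `R = L`, `JKlev L M k := JK (lev L k) L M`
typed in `lev L (k+1)` letters, same body as the staged file 5's `JGW L M k`) **`pairing_LapV_lev (k) u v : … ≤ cDir L·((L:ℝ)⁻¹)^k·√(…)·√(…)`** for EVERY `k`.  §4 splits the pairing of the owner's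
`localGW` EXACTLY: `⟨v,(JK·localGW_k − localGW_{k+1}·JK)u⟩ = ⟨v,(JK·LapV_k − LapV_{k+1}·JK)u⟩ + a·⟨v,(JK·Q_kᴴQ_k − Q_{k+1}ᴴQ_{k+1}·JK)u⟩`
(`pairing_localGW_eq`) — the second summand is the GRADED LINE-MASS COMMUTATOR pairing, the NEW estimate of (GW-L) (socket «(GW-L-mass)»,
NOT bounded here; leaf-03-g9's plan: the scale-`s_i` version of `LineAveragingPairing.sqrt_smul_QvOp_mul_JK` + a layer argument), and records
the budget dictionary `LapV A = localGW A − a•(Q_GWᴴQ_GW A)`, `Re⟨A, LapV A⟩ ≤ Re⟨A, localGW A⟩` (owner's `form_LapV_le_form_localGW`).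

HONEST FRAMING (T4-DAG p. 1).  [folklore] finite lattice bookkeeping at MODEL level (`U = 1`, finite torus, King's planting, the owner's graded
well with `m` FIXED); the constants are gan24's `cDir R = 2 + 8√(2R)`; nothing printed is a hypothesis or a conclusion; (GW-L) is NOT proved
here (open: the graded mass commutator, the coercivity (GW-L-co), the budget → operator-norm junction); NE2 (U1a) NOT proved; spine PROVED 0/9
unchanged; NOT [B9] (3.16)/(3.23)–(3.27)/(3.42) as printed; NOT infinite volume, NOT a mass gap, NOT the Clay problem.  HONEST DEPENDENCY:
continuum YM on T⁴ ⇐ BetaPertH ∧ nine spine estimates (0/9 proved); BetaPertH ⇐ (D1) ∧ (D4) ∧ CAP+tail; G-an2-4 gates asym, D1 and NE2/3/4.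
No `sorry`.
-/

noncomputable section

open scoped BigOperators ComplexConjugate Matrix
open Finset

namespace Summit.QuantumFields.BalabanUV.T4Continuum.TorusLaplacianTwoLevelPairing

open Literature.MathematicalPhysics.QuantumFieldTheory.Balaban1983to89.B5Prop11Plancherel (Tor fine fdiff)
open Literature.MathematicalPhysics.QuantumFieldTheory.Balaban1983to89.B5Prop11Lower (nsq nsq_nonneg star_dotProduct_self)
open Literature.MathematicalPhysics.QuantumFieldTheory.Balaban1983to89.B5Action121 (sdiff LapS LapV comp)
open Literature.MathematicalPhysics.QuantumFieldTheory.Balaban1983to89.B5LaplaceSpectral (form_LapS)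
open Literature.MathematicalPhysics.QuantumFieldTheory.Balaban1983to89.B5G183RateUnitTower (lev)
open Summit.QuantumFields.BalabanUV.T4Continuum
open Summit.QuantumFields.BalabanUV.T4Continuum.KingPairingPlantedLaw (JK)
open Summit.QuantumFields.BalabanUV.T4Continuum.ScalarBlockPlanting (JK0)
open Summit.QuantumFields.BalabanUV.T4Continuum.StarCarrierComponents (JK_apply_eq fdiff_sq_mulVec_apply)
open Summit.QuantumFields.BalabanUV.T4Continuum.BalabanAveragedTowerUnit (cast_lev' one_le_lev')
open Summit.QuantumFields.BalabanUV.T4Continuum.GradedWellData (TorK QvGW localGW localGW_eq form_LapV_le_form_localGW)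
open Summit.QuantumFields.BalabanUV.T4Continuum.DirichletCornerRegularity (cornerFree_univ suppIn_univ)
open Summit.QuantumFields.BalabanUV.Beta.GAN24.DirichletBoxTrace (blockReg)
open Summit.QuantumFields.BalabanUV.Beta.GAN24.DirichletBoxRegularity (Pdir LapS_eq_sum_Pdir Hdiag hdiag_le_sum_normSq_LapS)
open Summit.QuantumFields.BalabanUV.Beta.GAN24.DirichletBoxTwoLevel (budget budget_nonneg cDir cDir_nonneg pairing_le)

variable {d : ℕ}

/-! ## §1 The vector Laplacian and King's planting act component by component -/

section Comp

variable (N R : ℕ) [NeZero N] [NeZero R] (M : Fin d → ℕ) [hM : ∀ μ, NeZero (M μ)]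

/-- a dot product over the torus bonds is the sum over the components of the scalar dot products. [folklore] -/
theorem star_dotProduct_eq_sum_comp (n : ℕ) [NeZero n] (a b : Tor (fine n M) × Fin d → ℂ) :
    star a ⬝ᵥ b = ∑ ν, star (comp (fine n M) a ν) ⬝ᵥ comp (fine n M) b ν := by
  simp only [dotProduct, comp, Pi.star_apply]
  rw [Fintype.sum_prod_type, Finset.sum_comm]

/-- `nsq A = Σ_ν nsq A_ν`. [folklore] -/
theorem nsq_eq_sum_comp (n : ℕ) [NeZero n] (a : Tor (fine n M) × Fin d → ℂ) :
    nsq a = ∑ ν, nsq (comp (fine n M) a ν) := by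
  simp only [nsq, comp]
  rw [Fintype.sum_prod_type, Finset.sum_comm]

omit hM in
/-- components of a difference. [folklore] -/
theorem comp_sub (n : ℕ) [NeZero n] (a b : Tor (fine n M) × Fin d → ℂ) (ν : Fin d) :
    comp (fine n M) (a - b) ν = comp (fine n M) a ν - comp (fine n M) b ν := rfl

/-- **THE VECTOR LAPLACIAN IS THE SCALAR LAPLACIAN ON EVERY COMPONENT**: `(LapV u)_ν = Δ u_ν`. [folklore] -/
theorem comp_LapV_mulVec (n : ℕ) [NeZero n] (u : Tor (fine n M) × Fin d → ℂ) (ν : Fin d) :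
    comp (fine n M) (LapV (fine n M) (n : ℂ) *ᵥ u) ν = LapS (fine n M) (n : ℂ) *ᵥ comp (fine n M) u ν := by
  funext x
  show (LapV (fine n M) (n : ℂ) *ᵥ u) (x, ν) = (LapS (fine n M) (n : ℂ) *ᵥ fun y => u (y, ν)) x
  rw [LapV, Matrix.sum_mulVec, Finset.sum_apply, LapS_eq_sum_Pdir, Matrix.sum_mulVec, Finset.sum_apply]
  exact Finset.sum_congr rfl fun μ _ => fdiff_sq_mulVec_apply n M μ u x ν

/-- **KING's VECTOR PLANTING IS THE SCALAR PLANTING ON EVERY COMPONENT**: `(JK u)_ν = J₀ u_ν` (P4a's `JK_apply_eq`). [folklore] -/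
theorem comp_JK_mulVec (u : Tor (fine N M) × Fin d → ℂ) (ν : Fin d) :
    comp (fine (R * N) M) (JK N R M *ᵥ u) ν = JK0 N R M *ᵥ comp (fine N M) u ν := by
  funext x'
  simp only [comp, Matrix.mulVec, dotProduct]
  rw [Fintype.sum_prod_type]
  refine Finset.sum_congr rfl fun y _ => ?_
  simp only [JK_apply_eq, ite_mul, zero_mul, Finset.sum_ite_eq, Finset.mem_univ, if_true]

/-! ## §2 The two-level pairing of `LapV` is the sum of the scalar torus pairings of the components -/

/-- **THE COMPONENTWISE IDENTITY**:
`⟨v, (JK·LapV_N − LapV_{RN}·JK) u⟩ = Σ_ν ⟨v_ν, (J₀·Δ_N − Δ_{RN}·J₀) u_ν⟩`. [folklore] -/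
theorem pairing_LapV_eq_sum (u : Tor (fine N M) × Fin d → ℂ) (v : Tor (fine (R * N) M) × Fin d → ℂ) :
    star v ⬝ᵥ ((JK N R M * LapV (fine N M) (N : ℂ) - LapV (fine (R * N) M) ((R * N : ℕ) : ℂ) * JK N R M) *ᵥ u)
      = ∑ ν, star (comp (fine (R * N) M) v ν)
          ⬝ᵥ ((JK0 N R M * LapS (fine N M) (N : ℂ) - LapS (fine (R * N) M) ((R * N : ℕ) : ℂ) * JK0 N R M) *ᵥ comp (fine N M) u ν) := by
  rw [star_dotProduct_eq_sum_comp M (R * N) v]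
  refine Finset.sum_congr rfl fun ν _ => ?_
  congr 1
  rw [Matrix.sub_mulVec, Matrix.sub_mulVec, ← Matrix.mulVec_mulVec, ← Matrix.mulVec_mulVec, ← Matrix.mulVec_mulVec,
    ← Matrix.mulVec_mulVec, comp_sub, comp_JK_mulVec, comp_LapV_mulVec, comp_LapV_mulVec, comp_JK_mulVec]

end Comp

/-! ## §3 The torus budgets: every site is a block site -/

section Budget

variable (M : Fin d → ℕ) [hM : ∀ μ, NeZero (M μ)] (n : ℕ) [NeZero n]

/-- on the whole torus the block-region predicate is `True`. [folklore] -/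
theorem blockReg_top (x : Tor (fine n M)) : blockReg n M (fun _ => True) x := trivial

/-- at `S = ⊤` gan24's per-direction budget is the full gradient plus the full directional Hessian:
`budget ⊤ n μ z = ‖∂_μ z‖² + Σ_x |(∂_μᴴ∂_μ z)(x)|²`. [folklore] -/
theorem budget_top_eq (μ : Fin d) (z : Tor (fine n M) → ℂ) :
    budget M (fun _ => True) n μ z = nsq (sdiff (fine n M) (n : ℂ) μ *ᵥ z) + ∑ x, ‖(Pdir (fine n M) (n : ℂ) μ *ᵥ z) x‖ ^ 2 := by
  unfold budget
  rw [Finset.filter_true_of_mem (fun x _ => blockReg_top M n x)]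

/-- the gradients: `Σ_μ ‖∂_μ z‖² = Re⟨z, Δz⟩`. [folklore] -/
theorem sum_nsq_sdiff_eq (z : Tor (fine n M) → ℂ) :
    ∑ μ, nsq (sdiff (fine n M) (n : ℂ) μ *ᵥ z) = (star z ⬝ᵥ (LapS (fine n M) (n : ℂ) *ᵥ z)).re := by
  rw [form_LapS, Complex.re_sum]
  exact Finset.sum_congr rfl fun μ _ => by rw [star_dotProduct_self, Complex.ofReal_re]

/-- the directional Hessians: `Σ_μ Σ_x |(∂_μᴴ∂_μ z)(x)|² ≤ ‖Δz‖²` — THE TORUS IS CORNER-FREE (gan24's discrete `H²` identity with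
leaf-09-g10's `cornerFree_univ`). [folklore] -/
theorem sum_hess_le (z : Tor (fine n M) → ℂ) :
    ∑ μ, ∑ x, ‖(Pdir (fine n M) (n : ℂ) μ *ᵥ z) x‖ ^ 2 ≤ nsq (LapS (fine n M) (n : ℂ) *ᵥ z) := by
  have h := hdiag_le_sum_normSq_LapS (cornerFree_univ (N := fine n M)) (suppIn_univ z) (n : ℂ)
  unfold Hdiag at h
  unfold nsq
  exact h

/-- **THE TORUS BUDGET**: `Σ_μ budget ⊤ n μ z ≤ Re⟨z, Δz⟩ + ‖Δz‖²`. [folklore] -/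
theorem sum_budget_top_le (z : Tor (fine n M) → ℂ) :
    ∑ μ, budget M (fun _ => True) n μ z
      ≤ (star z ⬝ᵥ (LapS (fine n M) (n : ℂ) *ᵥ z)).re + nsq (LapS (fine n M) (n : ℂ) *ᵥ z) := by
  have h1 := sum_nsq_sdiff_eq M n z
  have h2 := sum_hess_le M n z
  have h3 : ∑ μ, budget M (fun _ => True) n μ z
      = ∑ μ, nsq (sdiff (fine n M) (n : ℂ) μ *ᵥ z) + ∑ μ, ∑ x, ‖(Pdir (fine n M) (n : ℂ) μ *ᵥ z) x‖ ^ 2 := by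
    rw [← Finset.sum_add_distrib]
    exact Finset.sum_congr rfl fun μ _ => budget_top_eq M n μ z
  linarith

/-- the vector budget of the file: `Re⟨A, LapV A⟩ + ‖LapV A‖²`, and its componentwise reading
`Σ_ν (Re⟨A_ν, ΔA_ν⟩ + ‖ΔA_ν‖²) = Re⟨A, LapV A⟩ + ‖LapV A‖²`. [folklore] -/
theorem sum_comp_budget_eq (A : Tor (fine n M) × Fin d → ℂ) :
    ∑ ν, ((star (comp (fine n M) A ν) ⬝ᵥ (LapS (fine n M) (n : ℂ) *ᵥ comp (fine n M) A ν)).re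
        + nsq (LapS (fine n M) (n : ℂ) *ᵥ comp (fine n M) A ν))
      = (star A ⬝ᵥ (LapV (fine n M) (n : ℂ) *ᵥ A)).re + nsq (LapV (fine n M) (n : ℂ) *ᵥ A) := by
  rw [Finset.sum_add_distrib, star_dotProduct_eq_sum_comp M n A, Complex.re_sum, nsq_eq_sum_comp M n (LapV (fine n M) (n : ℂ) *ᵥ A)]
  congr 1
  · exact Finset.sum_congr rfl fun ν _ => by rw [comp_LapV_mulVec]
  · exact Finset.sum_congr rfl fun ν _ => by rw [comp_LapV_mulVec]

/-- hence `Σ_ν Σ_μ budget ⊤ n μ A_ν ≤ Re⟨A, LapV A⟩ + ‖LapV A‖²`. [folklore] -/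
theorem sum_sum_budget_top_le (A : Tor (fine n M) × Fin d → ℂ) :
    ∑ ν, ∑ μ, budget M (fun _ => True) n μ (comp (fine n M) A ν)
      ≤ (star A ⬝ᵥ (LapV (fine n M) (n : ℂ) *ᵥ A)).re + nsq (LapV (fine n M) (n : ℂ) *ᵥ A) := by
  rw [← sum_comp_budget_eq M n A]
  exact Finset.sum_le_sum fun ν _ => sum_budget_top_le M n (comp (fine n M) A ν)

/-- the vector budget is nonnegative. [folklore] -/
theorem vbudget_nonneg (A : Tor (fine n M) × Fin d → ℂ) :
    0 ≤ (star A ⬝ᵥ (LapV (fine n M) (n : ℂ) *ᵥ A)).re + nsq (LapV (fine n M) (n : ℂ) *ᵥ A) :=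
  le_trans (Finset.sum_nonneg fun _ _ => Finset.sum_nonneg fun μ _ => budget_nonneg M _ n μ _) (sum_sum_budget_top_le M n A)

end Budget

/-! ## §4 THE TWO-LEVEL PAIRING OF THE TORUS VECTOR LAPLACIAN AT RATE `N⁻¹` -/

section Pairing

variable (N R : ℕ) [NeZero N] [NeZero R] (M : Fin d → ℕ) [hM : ∀ μ, NeZero (M μ)]

/-- **THE TWO-LEVEL PAIRING OF `LapV` AFTER KING's PLANTING, ON THE TORUS** (`1 ≤ N`; gan24's constant `cDir R = 2 + 8√(2R)`):
`‖⟨v, (JK·LapV_N − LapV_{RN}·JK) u⟩‖ ≤ (cDir R / N)·√(Re⟨u, LapV u⟩ + ‖LapV u‖²)·√(Re⟨v, LapV′ v⟩ + ‖LapV′ v‖²)` — rate `N⁻¹`: no wall,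
no carrier, no free end. [folklore] -/
theorem pairing_LapV_le (hN : 1 ≤ N) (u : Tor (fine N M) × Fin d → ℂ) (v : Tor (fine (R * N) M) × Fin d → ℂ) :
    ‖star v ⬝ᵥ ((JK N R M * LapV (fine N M) (N : ℂ) - LapV (fine (R * N) M) ((R * N : ℕ) : ℂ) * JK N R M) *ᵥ u)‖
      ≤ cDir R / N
          * (Real.sqrt ((star u ⬝ᵥ (LapV (fine N M) (N : ℂ) *ᵥ u)).re + nsq (LapV (fine N M) (N : ℂ) *ᵥ u))
            * Real.sqrt ((star v ⬝ᵥ (LapV (fine (R * N) M) ((R * N : ℕ) : ℂ) *ᵥ v)).re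
                + nsq (LapV (fine (R * N) M) ((R * N : ℕ) : ℂ) *ᵥ v))) := by
  have hNpos : (0 : ℝ) < N := by exact_mod_cast Nat.pos_of_ne_zero (NeZero.ne N)
  have hc : 0 ≤ cDir R / N := div_nonneg (cDir_nonneg R) hNpos.le
  -- the per-component budgets
  set x : Fin d → ℝ := fun ν => ∑ μ, budget M (fun _ => True) N μ (comp (fine N M) u ν) with hx
  set y : Fin d → ℝ := fun ν => ∑ μ, budget M (fun _ => True) (R * N) μ (comp (fine (R * N) M) v ν) with hy
  have hx0 : ∀ ν, 0 ≤ x ν := fun ν => Finset.sum_nonneg fun μ _ => budget_nonneg M _ N μ _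
  have hy0 : ∀ ν, 0 ≤ y ν := fun ν => Finset.sum_nonneg fun μ _ => budget_nonneg M _ (R * N) μ _
  -- gan24's scalar torus pairing on every component (support hypotheses vacuous at `S = ⊤`)
  have hcomp : ∀ ν ∈ (Finset.univ : Finset (Fin d)),
      ‖star (comp (fine (R * N) M) v ν)
          ⬝ᵥ ((JK0 N R M * LapS (fine N M) (N : ℂ) - LapS (fine (R * N) M) ((R * N : ℕ) : ℂ) * JK0 N R M) *ᵥ comp (fine N M) u ν)‖
        ≤ cDir R / N * (Real.sqrt (x ν) * Real.sqrt (y ν)) :=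
    fun ν _ => pairing_le N R M (fun _ => True) hN (fun z hz => absurd (blockReg_top M N z) hz)
      (fun z hz => absurd (blockReg_top M (R * N) z) hz)
  rw [pairing_LapV_eq_sum N R M u v]
  calc ‖∑ ν, star (comp (fine (R * N) M) v ν)
          ⬝ᵥ ((JK0 N R M * LapS (fine N M) (N : ℂ) - LapS (fine (R * N) M) ((R * N : ℕ) : ℂ) * JK0 N R M) *ᵥ comp (fine N M) u ν)‖
      ≤ ∑ ν, ‖star (comp (fine (R * N) M) v ν)
          ⬝ᵥ ((JK0 N R M * LapS (fine N M) (N : ℂ) - LapS (fine (R * N) M) ((R * N : ℕ) : ℂ) * JK0 N R M) *ᵥ comp (fine N M) u ν)‖ :=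
        norm_sum_le _ _
    _ ≤ ∑ ν, cDir R / N * (Real.sqrt (x ν) * Real.sqrt (y ν)) := Finset.sum_le_sum hcomp
    _ = cDir R / N * ∑ ν, Real.sqrt (x ν) * Real.sqrt (y ν) := by rw [Finset.mul_sum]
    _ ≤ cDir R / N * (Real.sqrt (∑ ν, x ν) * Real.sqrt (∑ ν, y ν)) :=
        mul_le_mul_of_nonneg_left (Real.sum_sqrt_mul_sqrt_le _ hx0 hy0) hc
    _ ≤ cDir R / N
          * (Real.sqrt ((star u ⬝ᵥ (LapV (fine N M) (N : ℂ) *ᵥ u)).re + nsq (LapV (fine N M) (N : ℂ) *ᵥ u))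
            * Real.sqrt ((star v ⬝ᵥ (LapV (fine (R * N) M) ((R * N : ℕ) : ℂ) *ᵥ v)).re
                + nsq (LapV (fine (R * N) M) ((R * N : ℕ) : ℂ) *ᵥ v))) :=
        mul_le_mul_of_nonneg_left (mul_le_mul (Real.sqrt_le_sqrt (sum_sum_budget_top_le M N u))
          (Real.sqrt_le_sqrt (sum_sum_budget_top_le M (R * N) v)) (Real.sqrt_nonneg _) (Real.sqrt_nonneg _)) hc

end Pairing

/-! ## §5 Along King's tower: rate `L^{−k}` at every rung -/

section Tower

variable (L : ℕ) [NeZero L] (M : Fin d → ℕ) [hM : ∀ μ, NeZero (M μ)]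

/-- KING's VECTOR PLANTING BETWEEN THE RUNGS `k`, `k + 1`, TYPED IN `lev L (k+1)` LETTERS: `JKlev L M k = JK (lev L k) L M` (definitionally; the same
body as the owner's staged `GradedWellResolventTower.JGW L M k` — the typed spelling lets `localGW (k+1) * JKlev k` elaborate, `lev L (k+1) = L·lev L k`
being `rfl` but not reducible for instance unification). [folklore] -/
def JKlev (k : ℕ) : Matrix (Tor (fine (lev L (k + 1)) M) × Fin d) (Tor (fine (lev L k) M) × Fin d) ℂ := JK (lev L k) L M

omit [NeZero L] hM in
/-- `JKlev = JK (lev L k) L M`. [folklore] -/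
theorem JKlev_eq (k : ℕ) : JKlev L M k = JK (lev L k) L M := rfl

omit [NeZero L] hM in
/-- `cDir L / lev L k = cDir L·(L⁻¹)^k`. [folklore] -/
theorem cDir_div_lev (k : ℕ) : cDir L / ((lev L k : ℕ) : ℝ) = cDir L * ((L : ℝ)⁻¹) ^ k := by
  rw [cast_lev', div_eq_mul_inv, inv_pow]

/-- **THE TWO-LEVEL PAIRING OF `LapV` ALONG KING's TOWER** (`N = lev L k`, `R = L`; `JKlev L M k = JK (lev L k) L M`, the body of the graded well's staged `JGW L M k`):
`‖⟨v, (JK k·LapV_k − LapV_{k+1}·JK k) u⟩‖ ≤ cDir L·(L⁻¹)^k·√(Re⟨u, LapV_k u⟩ + ‖LapV_k u‖²)·√(Re⟨v, LapV_{k+1} v⟩ + ‖LapV_{k+1} v‖²)`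
for EVERY `k`. [folklore] -/
theorem pairing_LapV_lev (k : ℕ) (u : Tor (fine (lev L k) M) × Fin d → ℂ) (v : Tor (fine (lev L (k + 1)) M) × Fin d → ℂ) :
    ‖star v ⬝ᵥ ((JKlev L M k * LapV (fine (lev L k) M) ((lev L k : ℕ) : ℂ)
        - LapV (fine (lev L (k + 1)) M) ((lev L (k + 1) : ℕ) : ℂ) * JKlev L M k) *ᵥ u)‖
      ≤ cDir L * ((L : ℝ)⁻¹) ^ k
          * (Real.sqrt ((star u ⬝ᵥ (LapV (fine (lev L k) M) ((lev L k : ℕ) : ℂ) *ᵥ u)).re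
                + nsq (LapV (fine (lev L k) M) ((lev L k : ℕ) : ℂ) *ᵥ u))
            * Real.sqrt ((star v ⬝ᵥ (LapV (fine (lev L (k + 1)) M) ((lev L (k + 1) : ℕ) : ℂ) *ᵥ v)).re
                + nsq (LapV (fine (lev L (k + 1)) M) ((lev L (k + 1) : ℕ) : ℂ) *ᵥ v))) := by
  rw [← cDir_div_lev L k]
  exact pairing_LapV_le (lev L k) L M (one_le_lev' L k) u v

end Tower

/-! ## §6 The owner's `localGW`: the pairing splits into the `LapV` pairing and the graded line-mass commutator -/

section GradedWell

variable (L : ℕ) [NeZero L] (M : Fin d → ℕ) [hM : ∀ μ, NeZero (M μ)] (k m : ℕ) (layer : Tor M → ℕ) (a : ℝ)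

/-- `LapV A = localGW A − a•(Q_GWᴴQ_GW A)` (the owner's `localGW_eq`). [folklore] -/
theorem LapV_mulVec_eq (A : TorK L M k × Fin d → ℂ) :
    LapV (fine (lev L k) M) ((lev L k : ℕ) : ℂ) *ᵥ A
      = localGW L M k m layer a *ᵥ A - (a : ℂ) • (((QvGW L M k m layer)ᴴ * QvGW L M k m layer) *ᵥ A) := by
  rw [localGW_eq, Matrix.add_mulVec, Matrix.smul_mulVec, add_sub_cancel_right]

/-- the form dictionary: `Re⟨A, LapV A⟩ ≤ Re⟨A, localGW A⟩` for `0 ≤ a` (the owner's `form_LapV_le_form_localGW`, recorded for the junction).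
[folklore] -/
theorem form_LapV_le (ha : 0 ≤ a) (A : TorK L M k × Fin d → ℂ) :
    (star A ⬝ᵥ (LapV (fine (lev L k) M) ((lev L k : ℕ) : ℂ) *ᵥ A)).re ≤ (star A ⬝ᵥ (localGW L M k m layer a *ᵥ A)).re :=
  form_LapV_le_form_localGW L M k m layer a ha A

/-- **THE SPLIT OF THE (GW-L) PAIRING**: for the owner's `localGW = LapV + a•Q_GWᴴQ_GW`,
`⟨v, (JK·localGW_k − localGW_{k+1}·JK) u⟩ = ⟨v, (JK·LapV_k − LapV_{k+1}·JK) u⟩ + a·⟨v, (JK·Q_kᴴQ_k − Q_{k+1}ᴴQ_{k+1}·JK) u⟩` — the first summand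
is `pairing_LapV_lev`'s (rate `L^{−k}`), the second is the GRADED LINE-MASS COMMUTATOR pairing (socket (GW-L-mass), open). [folklore] -/
theorem pairing_localGW_eq (u : TorK L M k × Fin d → ℂ) (v : TorK L M (k + 1) × Fin d → ℂ) :
    star v ⬝ᵥ ((JKlev L M k * localGW L M k m layer a - localGW L M (k + 1) m layer a * JKlev L M k) *ᵥ u)
      = star v ⬝ᵥ ((JKlev L M k * LapV (fine (lev L k) M) ((lev L k : ℕ) : ℂ)
            - LapV (fine (lev L (k + 1)) M) ((lev L (k + 1) : ℕ) : ℂ) * JKlev L M k) *ᵥ u)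
        + (a : ℂ) * (star v ⬝ᵥ ((JKlev L M k * ((QvGW L M k m layer)ᴴ * QvGW L M k m layer)
            - ((QvGW L M (k + 1) m layer)ᴴ * QvGW L M (k + 1) m layer) * JKlev L M k) *ᵥ u)) := by
  rw [localGW_eq, localGW_eq, Matrix.mul_add, Matrix.add_mul, Matrix.mul_smul, Matrix.smul_mul, add_sub_add_comm, ← smul_sub,
    Matrix.add_mulVec, dotProduct_add, Matrix.smul_mulVec, dotProduct_smul, smul_eq_mul]

/-- **(GW-L) IN THE PAIRING CURRENCY, MODULO THE GRADED MASS COMMUTATOR**: if the graded line-mass commutator pairs at `εM` against budgets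
`Bu`, `Bv`, then `‖⟨v, (JK·localGW_k − localGW_{k+1}·JK) u⟩‖ ≤ cDir L·(L⁻¹)^k·√(LapV-budget u)·√(LapV-budget v) + a·εM·Bu·Bv`
(`0 ≤ a`). [folklore] -/
theorem pairing_localGW_le (ha : 0 ≤ a) (u : TorK L M k × Fin d → ℂ) (v : TorK L M (k + 1) × Fin d → ℂ) {εM Bu Bv : ℝ}
    (hM : ‖star v ⬝ᵥ ((JKlev L M k * ((QvGW L M k m layer)ᴴ * QvGW L M k m layer)
            - ((QvGW L M (k + 1) m layer)ᴴ * QvGW L M (k + 1) m layer) * JKlev L M k) *ᵥ u)‖ ≤ εM * Bu * Bv) :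
    ‖star v ⬝ᵥ ((JKlev L M k * localGW L M k m layer a - localGW L M (k + 1) m layer a * JKlev L M k) *ᵥ u)‖
      ≤ cDir L * ((L : ℝ)⁻¹) ^ k
          * (Real.sqrt ((star u ⬝ᵥ (LapV (fine (lev L k) M) ((lev L k : ℕ) : ℂ) *ᵥ u)).re
                + nsq (LapV (fine (lev L k) M) ((lev L k : ℕ) : ℂ) *ᵥ u))
            * Real.sqrt ((star v ⬝ᵥ (LapV (fine (lev L (k + 1)) M) ((lev L (k + 1) : ℕ) : ℂ) *ᵥ v)).re
                + nsq (LapV (fine (lev L (k + 1)) M) ((lev L (k + 1) : ℕ) : ℂ) *ᵥ v)))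
        + a * (εM * Bu * Bv) := by
  rw [pairing_localGW_eq]
  refine (norm_add_le _ _).trans (add_le_add (pairing_LapV_lev L M k u v) ?_)
  rw [norm_mul, Complex.norm_real, Real.norm_of_nonneg ha]
  exact mul_le_mul_of_nonneg_left hM ha

end GradedWell

end Summit.QuantumFields.BalabanUV.T4Continuum.TorusLaplacianTwoLevelPairing

end
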